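/-
Copyright (c) 2026 the pub-hodgecm-mathlib formalisation cell (harness21).  Prover seat hodgecm-mathlib-K2Liu-p05 (g0): Track B «K2-LIT»,
#184♮ = hLiu418 = stmt-HodgeConjecture-24832; organ (R) «reduction to one-place slices» of socket #32d `sig_K2LiuDoublingHeightDecayLocal`
of `Cruxes/HLiu418/Lines/K2_Liu_CurveThetaSigs_U5d_ZetaS.lean` (ED. 1 a836627a4002dcd3 :224), file 2b; REPORT-FIRST K2/STATUS 2026-09-04.
-/
import Summits.HodgeConjecture.HodgeConjecture.Theorems.K2LiuDoublingHeightQuasiFactorization   -- file 1: `exists_quasiFactorization_place`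
import Summits.HodgeConjecture.HodgeConjecture.Theorems.K2LiuDoublingUnfoldBridge               -- ★ H5: `exists_continuousMulEquiv_eq_iotaA` (`ιA` is a `≃ₜ*`)
import Summits.HodgeConjecture.HodgeConjecture.Theorems.K2LiuDoublingEmbeddingPlaceComponents   -- file 2a: place components of `ι ∘ ιA ∘ placesEmbed`
import Mathlib.MeasureTheory.Integral.Pi                                                       -- `Integrable.fintype_prod_dep`
import Mathlib.Analysis.SpecialFunctions.Pow.NNReal                                            -- `Real.finsetProd_rpow`
import HarnessLib

/-!
# Crux `HLiu418`, road `K2_Liu`, unit U5d, socket #32d — organ (R), file 2b: LOCAL DECAY ON `G_∞ × G_S` FROM THE ONE-PLACE SLICES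

Cell `hodgecm-mathlib`, crux item hLiu418 = `stmt-HodgeConjecture-24832`; squad K2 ∕ K2Liu, LEAD F0P6-plan (g10), planner K2Liu-plan (g2), prover
K2Liu-p05 (g0).  THEOREMS ONLY (no `def` ∕ instance ∕ notation ∕ named-fact hypothesis ∕ `sorry`, default heartbeats); lane
`--supports stmt-HodgeConjecture-24832 --as helper` (count-neutral).

WHAT IS PROVED.  **`doublingHeightDecayLocal_of_slices`** — under the binders of socket #32d `sig_K2LiuDoublingHeightDecayLocal` (U5d ED. 1 :224:
frame `t, g, ιA` pinned by `_hιA`, finite `S`, Haar `ν_∞`, `(ν_v)_{v∈S}`, continuous height `Φ > 0` of type `(P_Δ, modDelta)` on `H(𝔸)`) and for ANY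
real `τ`: if the archimedean slice `a ↦ Φ(ι(ιA placesEmbed(a, 1), 1))^τ` is `ν_∞`-integrable and every `v`-slice
`u ↦ Φ(ι(ιA placesEmbed(1, (u at v, 1 elsewhere)), 1))^τ` (`v ∈ S`) is `ν_v`-integrable, then the socket's integrand `x ↦ Φ(ι(ιA placesEmbed x, 1))^τ`
is integrable for `ν_∞ ⊗ ⊗_{v∈S} ν_v`.  So #32d is the conjunction of its one-place slices at the sharp exponent `τ > 2N − 2` (archimedean `U(H_σ)(ℝ)`;
split ∕ inert ∕ ramified `v ∈ S`) — the organs that remain ([GelbartPiatetskishapiroRallis1987, Part A §2, §6]; [Li1992, §3]; [Liu2011, §2B Prop. 2.3]).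

PROOF.  §1–§2 (file 2a ★ `K2LiuDoublingEmbeddingPlaceComponents`): `ι ∘ ιA` preserves trivial place components; the place components of
★ `placesEmbed S (a, y)` and the peeling identity `y = (y with y_{v₀} := 1)·(y_{v₀} at v₀)`.  §3 real bookkeeping: two-sided `X ≍_C Y` gives `X^τ ≤ max(C^τ, C^{−τ})·Y^τ` for
every real `τ` (the `N = 0` corner has negative exponents).  §4 an ABSTRACT peeling lemma (induction on the support of `y ∈ Π_i G_i`) instantiated with
`Θ(a, y) = Φ(ι ιA placesEmbed(a, y))`, the step being file 1's ★ `exists_quasiFactorization_place` fed by §1–§2 — no rewriting inside a goal holding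
two different `placesEmbed` terms (`kabstract` would unfold the adelic pipeline and time out; equalities travel by `congrArg`∕`trans_le`).  §5 the
reduction: Mathlib `Integrable.mul_prod` + `Integrable.fintype_prod_dep` for the majorant, continuity of the integrand (Borel bookkeeping as in ★
`K2LiuZetaSHolomorphic`), `Integrable.mono'`.

HONEST LABEL.  Count-neutral helper (organ (R) of #32d); #32d stays OPEN until its slices are paid: `HC_CM` is proved only modulo the 7 printed
citations (2 remaining named inputs: hLiu418 = `stmt-HodgeConjecture-24832`, h413 = `stmt-HodgeConjecture-24833`) until rung 0 closes.
References: [GelbartPiatetskishapiroRallis1987] LNM 1254, Part A §2, §6; [Li1992] J. reine angew. Math. 428, §3 Thm. 3.1; [Liu2011] ANT 5, §2B Prop. 2.3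
p. 862; [BorelJacquet1979] PSPM 33.1, §4.1; [HarrisKudlaSweet1996] JAMS 9, §1 (1.11); [Garrett2018] §3.10.
-/

set_option autoImplicit false
-- the mandated namespace repeats the single-problem summit's segment (`HodgeConjecture.HodgeConjecture`)
set_option linter.dupNamespace false

noncomputable section

open scoped Matrix
open NumberField IsDedekindDomain MeasureTheory

namespace Summit.HodgeConjecture.HodgeConjecture.Cruxes.HLiu418.K2LiuDoublingHeightDecayLocalOfSlices

open Literature.NumberTheory.Automorphic Literature.NumberTheory.Automorphic.UnitaryGroup
open Literature.NumberTheory.GelbartRogawski1991 Literature.NumberTheory.GelbartRogawski1991.GRConstruction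
open Literature.NumberTheory.K2Lit.SiegelDoubled Literature.NumberTheory.K2Lit.PlaceSplitting
open Summit.HodgeConjecture.HodgeConjecture.Cruxes.HLiu418.K2LiuDoublingHeightQuasiFactorization
open Summit.HodgeConjecture.HodgeConjecture.Cruxes.HLiu418.K2LiuDoublingUnfoldBridge
open Summit.HodgeConjecture.HodgeConjecture.Cruxes.HLiu418.K2LiuDoublingEmbeddingPlaceComponents

variable (L : Type) [Field L] [NumberField L] [IsCMField L]
variable {N M n : ℕ} (e : Fin N × Fin M ≃ Fin n)
  (dV : Fin N → L) (hdV : ∀ i, IsCMField.complexConj L (dV i) = dV i)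
  (dW : Fin M → L) (hdW : ∀ i, IsCMField.complexConj L (dW i) = dW i)

/-! ## §3 Two-sided real-power bookkeeping -/

/-- from `X ≤ C·Y` and `Y ≤ C·X` (`X, Y, C > 0`): `X^τ ≤ max(C^τ, C^{−τ})·Y^τ` for EVERY real `τ`. [cite: Garrett2018, §3.10] -/
theorem rpow_le_max_mul_rpow {X Y C τ : ℝ} (hX : 0 < X) (hY : 0 < Y) (hC : 0 < C) (h₁ : X ≤ C * Y) (h₂ : Y ≤ C * X) :
    X ^ τ ≤ max (C ^ τ) (C ^ (-τ)) * Y ^ τ := by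
  rcases le_or_gt 0 τ with hτ | hτ
  · calc X ^ τ ≤ (C * Y) ^ τ := Real.rpow_le_rpow hX.le h₁ hτ
      _ = C ^ τ * Y ^ τ := Real.mul_rpow hC.le hY.le
      _ ≤ max (C ^ τ) (C ^ (-τ)) * Y ^ τ := mul_le_mul_of_nonneg_right (le_max_left _ _) (Real.rpow_nonneg hY.le τ)
  · have h₃ : Y / C ≤ X := by rw [div_le_iff₀ hC]; linarith [mul_comm C X]
    calc X ^ τ ≤ (Y / C) ^ τ := Real.rpow_le_rpow_of_nonpos (div_pos hY hC) h₃ hτ.le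
      _ = C ^ (-τ) * Y ^ τ := by
          rw [Real.div_rpow hY.le hC.le, Real.rpow_neg hC.le, div_eq_mul_inv, mul_comm]
      _ ≤ max (C ^ τ) (C ^ (-τ)) * Y ^ τ := mul_le_mul_of_nonneg_right (le_max_right _ _) (Real.rpow_nonneg hY.le τ)

/-- the arithmetic of one peeling step of the induction over `S` (two-sided constants multiply). [cite: Garrett2018, §3.10] -/
theorem twoSided_step {ΦAB ΦA ΦB Φ₀ P Cv CT : ℝ} (hB0 : 0 ≤ ΦB) (hCv : 0 ≤ Cv) (hCT : 0 ≤ CT)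
    (h1 : ΦAB ≤ Cv * (ΦA * ΦB)) (h2 : ΦA * ΦB ≤ Cv * ΦAB) (h3 : ΦA ≤ CT * (Φ₀ * P)) (h4 : Φ₀ * P ≤ CT * ΦA) :
    ΦAB ≤ Cv * CT * (Φ₀ * (ΦB * P)) ∧ Φ₀ * (ΦB * P) ≤ Cv * CT * ΦAB := by
  constructor
  · calc ΦAB ≤ Cv * (ΦA * ΦB) := h1
      _ ≤ Cv * (CT * (Φ₀ * P) * ΦB) := mul_le_mul_of_nonneg_left (mul_le_mul_of_nonneg_right h3 hB0) hCv
      _ = Cv * CT * (Φ₀ * (ΦB * P)) := by ring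
  · calc Φ₀ * (ΦB * P) = Φ₀ * P * ΦB := by ring
      _ ≤ CT * ΦA * ΦB := mul_le_mul_of_nonneg_right h4 hB0
      _ = CT * (ΦA * ΦB) := by ring
      _ ≤ CT * (Cv * ΦAB) := mul_le_mul_of_nonneg_left h2 hCT
      _ = Cv * CT * ΦAB := by ring

/-! ## §4 The quasi-factorisation over `S`: `Φ(ι ιA(a, y)) ≍ Φ(ι ιA(a, 1)) · ∏_{v∈S} Φ(ι ιA(1, y_v))` -/

section Abstract

variable {ι : Type*} [Fintype ι] [DecidableEq ι] {G : ι → Type*} [∀ i, One (G i)] {A : Type*} [One A]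

/-- **ABSTRACT PEELING.**  If a positive function `Θ(a, y)` of `a ∈ A` and `y ∈ Π_i G_i` is two-sidedly comparable, for every coordinate `i`, with
`Θ(a, y with y_i := 1) · Θ(1, (y_i at i))`, then it is two-sidedly comparable with `Θ(a, 1) · ∏_i Θ(1, (y_i at i))` (induction on the support
of `y`). [cite: BorelJacquet1979, §4.1] -/
theorem exists_twoSided_of_step (Θ : A → (Π i, G i) → ℝ) (hΘ : ∀ a y, 0 < Θ a y)
    (hstep : ∀ i : ι, ∃ C : ℝ, 0 < C ∧ ∀ (a : A) (y : Π i, G i),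
      Θ a y ≤ C * (Θ a (Function.update y i 1) * Θ 1 (Pi.mulSingle i (y i))) ∧
        Θ a (Function.update y i 1) * Θ 1 (Pi.mulSingle i (y i)) ≤ C * Θ a y) :
    ∃ C : ℝ, 0 < C ∧ ∀ (a : A) (y : Π i, G i),
      Θ a y ≤ C * (Θ a 1 * ∏ i, Θ 1 (Pi.mulSingle i (y i))) ∧ Θ a 1 * ∏ i, Θ 1 (Pi.mulSingle i (y i)) ≤ C * Θ a y := by
  classical
  suffices key : ∀ T : Finset ι, ∃ C : ℝ, 0 < C ∧ ∀ (a : A) (y : Π i, G i), (∀ i, i ∉ T → y i = 1) →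
      Θ a y ≤ C * (Θ a 1 * ∏ i ∈ T, Θ 1 (Pi.mulSingle i (y i))) ∧
        Θ a 1 * ∏ i ∈ T, Θ 1 (Pi.mulSingle i (y i)) ≤ C * Θ a y by
    obtain ⟨C, hC, h⟩ := key Finset.univ
    exact ⟨C, hC, fun a y => h a y fun i hi => (hi (Finset.mem_univ i)).elim⟩
  intro T
  induction T using Finset.induction_on with
  | empty =>
      refine ⟨1, one_pos, fun a y hy => ?_⟩
      have hy1 : y = 1 := funext fun i => hy i (Finset.notMem_empty i)
      subst hy1
      rw [Finset.prod_empty, mul_one, one_mul]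
      exact ⟨le_rfl, le_rfl⟩
  | insert i₀ T hi₀ ih =>
      obtain ⟨CT, hCT, hT⟩ := ih
      obtain ⟨Ci, hCi, hi⟩ := hstep i₀
      refine ⟨Ci * CT, mul_pos hCi hCT, fun a y hy => ?_⟩
      have hy's : ∀ i, i ∉ T → Function.update y i₀ 1 i = 1 := fun i hiT => by
        rcases eq_or_ne i i₀ with rfl | hne
        · exact Function.update_self _ _ _
        · rw [Function.update_of_ne hne]
          exact hy i fun h => (Finset.mem_insert.1 h).elim hne hiT
      have hq := hi a y
      have hT' := hT a (Function.update y i₀ 1) hy's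
      have hprod : ∏ i ∈ insert i₀ T, Θ 1 (Pi.mulSingle i (y i)) =
          Θ 1 (Pi.mulSingle i₀ (y i₀)) * ∏ i ∈ T, Θ 1 (Pi.mulSingle i (Function.update y i₀ 1 i)) := by
        rw [Finset.prod_insert hi₀]
        congr 1
        exact Finset.prod_congr rfl fun i hiT => by rw [Function.update_of_ne (ne_of_mem_of_not_mem hiT hi₀)]
      rw [hprod]
      exact twoSided_step (hΘ _ _).le hCi.le hCT.le hq.1 hq.2 hT'.1 hT'.2

end Abstract

section Slices

variable (H : Matrix (Fin N) (Fin N) L) (g : GL (Fin N) L)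
  (ιA : (UnitaryGroup.adelicGroupData (Fp L) L (IsCMField.complexConj L) N H).Adelic →*
    UnitaryGroup.adelic (Fp L) L (IsCMField.complexConj L) N (Matrix.diagonal dV))
  (hιA : ∀ k, ((ιA k : ↥(UnitaryGroup.adelic (Fp L) L (IsCMField.complexConj L) N (Matrix.diagonal dV))) :
        GL (Fin N) (AdeleRing (𝓞 L) L)) =
      (toAdeleGL L g)⁻¹ * UnitaryGroup.adelicVal (Fp L) L (IsCMField.complexConj L) N H k * toAdeleGL L g)
  (S : Finset (HeightOneSpectrum (𝓞 (Fp L)))) [DecidableEq (HeightOneSpectrum (𝓞 (Fp L)))]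

include hιA in
/-- **THE QUASI-FACTORISATION OVER `S`.**  For non-degenerate data and a continuous height `Φ > 0` of type `(P_Δ, modDelta)` on `H(𝔸)` there is
`C > 0` with, for all `a ∈ G_∞` and `y ∈ Π_{v∈S} G_v`:
`Φ(ι(ιA(a, y), 1)) ≤ C · Φ(ι(ιA(a, 1), 1)) · ∏_{v∈S} Φ(ι(ιA(1, y_v), 1))` and the reverse inequality — `exists_twoSided_of_step`, the step being
★ `exists_quasiFactorization_place` (§1–§2 supply its support hypotheses).
[cite: GelbartPiatetskishapiroRallis1987, Part A §2] [cite: BorelJacquet1979, §4.1] [cite: Liu2011, §2B Prop. 2.3 p. 862] -/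
theorem exists_twoSided_placesEmbed (hdV0 : ∀ i, dV i ≠ 0) (hdW0 : ∀ i, dW i ≠ 0)
    {Φ : HA L e dV hdV dW hdW → ℝ} (hΦc : Continuous Φ) (hΦpos : ∀ x, 0 < Φ x)
    (hΦ : ∀ p x : HA L e dV hdV dW hdW, IsSiegelDelta L e dV hdV dW hdW p →
      Φ (p * x) = modDelta L e dV hdV dW hdW p * Φ x) :
    ∃ C : ℝ, 0 < C ∧ ∀ (a : UnitaryGroup.arch (Fp L) L (IsCMField.complexConj L) N H)
      (y : Π v : S, UnitaryGroup.localPi L (IsCMField.complexConj L) N H v.1),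
      Φ (iotaLeft L e dV hdV dW hdW (ιA (placesEmbed L H S (a, y)))) ≤
          C * (Φ (iotaLeft L e dV hdV dW hdW (ιA (placesEmbed L H S (a, 1)))) *
            ∏ v : S, Φ (iotaLeft L e dV hdV dW hdW (ιA (placesEmbed L H S (1, Pi.mulSingle v (y v)))))) ∧
        Φ (iotaLeft L e dV hdV dW hdW (ιA (placesEmbed L H S (a, 1)))) *
            ∏ v : S, Φ (iotaLeft L e dV hdV dW hdW (ιA (placesEmbed L H S (1, Pi.mulSingle v (y v))))) ≤
          C * Φ (iotaLeft L e dV hdV dW hdW (ιA (placesEmbed L H S (a, y)))) := by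
  refine exists_twoSided_of_step
    (fun (a : UnitaryGroup.arch (Fp L) L (IsCMField.complexConj L) N H)
      (y : Π v : S, UnitaryGroup.localPi L (IsCMField.complexConj L) N H v.1) =>
        Φ (iotaLeft L e dV hdV dW hdW (ιA (placesEmbed L H S (a, y)))))
    (fun a y => hΦpos _) fun v₀ => ?_
  obtain ⟨Cv, hCv, hv⟩ := exists_quasiFactorization_place L e dV hdV dW hdW hdV0 hdW0 hΦc hΦpos hΦ v₀.1
  refine ⟨Cv, hCv, fun a y => ?_⟩
  -- peel the place `v₀`: `(a, y) = (a, y') · (1, y_{v₀} at v₀)` with `y' := Function.update y v₀ 1`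
  have hsplit : placesEmbed L H S (a, y) =
      placesEmbed L H S (a, Function.update y v₀ 1) * placesEmbed L H S (1, Pi.mulSingle v₀ (y v₀)) := by
    rw [← map_mul, Prod.mk_mul_mk, mul_one, update_mul_mulSingle]
  have hAB : iotaLeft L e dV hdV dW hdW (ιA (placesEmbed L H S (a, y))) =
      iotaLeft L e dV hdV dW hdW (ιA (placesEmbed L H S (a, Function.update y v₀ 1))) *
        iotaLeft L e dV hdV dW hdW (ιA (placesEmbed L H S (1, Pi.mulSingle v₀ (y v₀)))) := by
    rw [hsplit, map_mul, map_mul]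
  -- the support facts required by `exists_quasiFactorization_place`
  have hA : UnitaryGroup.evalPlace (Fp L) L (IsCMField.complexConj L) (n + n) (hermD L e dV hdV dW hdW) v₀.1
      (UnitaryGroup.finPart (Fp L) L (IsCMField.complexConj L) (n + n) (hermD L e dV hdV dW hdW)
        (iotaLeft L e dV hdV dW hdW (ιA (placesEmbed L H S (a, Function.update y v₀ 1))))) = 1 := by
    refine evalPlace_finPart_iotaLeft_eq_one L e dV hdV dW hdW v₀.1 _
      (evalPlace_finPart_iotaA_eq_one L H dV g ιA hιA v₀.1 _ ?_)
    rw [finPart_placesEmbed, evalPlace_placesEmbedFin_of_mem L H S _ v₀.1 v₀.2]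
    exact Function.update_self _ _ _
  have hB1 : UnitaryGroup.archPart (Fp L) L (IsCMField.complexConj L) (n + n) (hermD L e dV hdV dW hdW)
      (iotaLeft L e dV hdV dW hdW (ιA (placesEmbed L H S (1, Pi.mulSingle v₀ (y v₀))))) = 1 :=
    archPart_iotaLeft_eq_one L e dV hdV dW hdW _
      (archPart_iotaA_eq_one L H dV g ιA hιA _ (archPart_placesEmbed L H S 1 _))
  have hB2 : ∀ w : HeightOneSpectrum (𝓞 (Fp L)), w ≠ v₀.1 →
      UnitaryGroup.evalPlace (Fp L) L (IsCMField.complexConj L) (n + n) (hermD L e dV hdV dW hdW) w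
        (UnitaryGroup.finPart (Fp L) L (IsCMField.complexConj L) (n + n) (hermD L e dV hdV dW hdW)
          (iotaLeft L e dV hdV dW hdW (ιA (placesEmbed L H S (1, Pi.mulSingle v₀ (y v₀)))))) = 1 := by
    intro w hw
    refine evalPlace_finPart_iotaLeft_eq_one L e dV hdV dW hdW w _
      (evalPlace_finPart_iotaA_eq_one L H dV g ιA hιA w _ ?_)
    rw [finPart_placesEmbed]
    by_cases hwS : w ∈ S
    · rw [evalPlace_placesEmbedFin_of_mem L H S _ w hwS, Pi.mulSingle_eq_of_ne]
      exact fun h => hw (congrArg Subtype.val h)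
    · exact evalPlace_placesEmbedFin_of_not_mem L H S _ w hwS
  have hq := hv _ _ hA hB1 hB2
  exact ⟨(congrArg Φ hAB).trans_le hq.1, hq.2.trans_eq (congrArg (fun z => Cv * Φ z) hAB).symm⟩

end Slices

/-! ## §5 The reduction of socket #32d to its one-place slices -/

/-- **#32d FOLLOWS FROM ITS ONE-PLACE SLICES.**  Under the binders of socket #32d `sig_K2LiuDoublingHeightDecayLocal` (U5d ED. 1 :224) and for ANY
real exponent `τ`: if the archimedean slice `a ↦ Φ(ι(ιA(placesEmbed(a, 1)), 1))^τ` is `ν_∞`-integrable and, for every `v ∈ S`, the `v`-slice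
`u ↦ Φ(ι(ιA(placesEmbed(1, (u at v, 1 elsewhere))), 1))^τ` is `ν_v`-integrable, then `x ↦ Φ(ι(ιA(placesEmbed x), 1))^τ` is integrable for
`ν_∞ ⊗ ⊗_{v∈S} ν_v` — the socket's conclusion.  (§4's two-sided bound, `Integrable.mul_prod`, `Integrable.fintype_prod_dep`, continuity of the
integrand.) [cite: GelbartPiatetskishapiroRallis1987, Part A §2, §6] [cite: Li1992, §3 Thm. 3.1] [cite: Liu2011, §2B Prop. 2.3 p. 862] -/
theorem doublingHeightDecayLocal_of_slices :
    ∀ (L : Type) [Field L] [NumberField L] [IsCMField L] {N n : ℕ} (e : Fin N × Fin 1 ≃ Fin n)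
      (dV : Fin N → L) (hdV : ∀ i, IsCMField.complexConj L (dV i) = dV i) (_hdV0 : ∀ i, dV i ≠ 0)
      (dW : Fin 1 → L) (hdW : ∀ i, IsCMField.complexConj L (dW i) = dW i) (_hdW0 : ∀ i, dW i ≠ 0)
      (H : Matrix (Fin N) (Fin N) L)
      (t : L) (_ht : t ≠ 0) (g : GL (Fin N) L)
      (_hg : formCongr ((IsCMField.complexConj L : L ≃ₐ[↥(maximalRealSubfield L)] L) : L →+* L) g (t • H) = Matrix.diagonal dV)
      (ιA : (UnitaryGroup.adelicGroupData (Fp L) L (IsCMField.complexConj L) N H).Adelic →*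
        UnitaryGroup.adelic (Fp L) L (IsCMField.complexConj L) N (Matrix.diagonal dV))
      (_hιA : ∀ k, ((ιA k : ↥(UnitaryGroup.adelic (Fp L) L (IsCMField.complexConj L) N (Matrix.diagonal dV))) :
            GL (Fin N) (AdeleRing (𝓞 L) L)) =
          (toAdeleGL L g)⁻¹ * UnitaryGroup.adelicVal (Fp L) L (IsCMField.complexConj L) N H k * toAdeleGL L g)
      (S : Finset (HeightOneSpectrum (𝓞 (Fp L)))) [DecidableEq (HeightOneSpectrum (𝓞 (Fp L)))]
      [MeasurableSpace (UnitaryGroup.arch (Fp L) L (IsCMField.complexConj L) N H)]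
      [BorelSpace (UnitaryGroup.arch (Fp L) L (IsCMField.complexConj L) N H)]
      [∀ v : HeightOneSpectrum (𝓞 (Fp L)), MeasurableSpace (UnitaryGroup.localPi L (IsCMField.complexConj L) N H v)]
      [∀ v : HeightOneSpectrum (𝓞 (Fp L)), BorelSpace (UnitaryGroup.localPi L (IsCMField.complexConj L) N H v)]
      (νinf : Measure (UnitaryGroup.arch (Fp L) L (IsCMField.complexConj L) N H)) [νinf.IsHaarMeasure]
      (νS : ∀ v : S, Measure (UnitaryGroup.localPi L (IsCMField.complexConj L) N H v.1)) [∀ v, (νS v).IsHaarMeasure]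
      (Φ : HA L e dV hdV dW hdW → ℝ) (_hΦc : Continuous Φ) (_hΦpos : ∀ x, 0 < Φ x)
      (_hΦ : ∀ p x : HA L e dV hdV dW hdW, IsSiegelDelta L e dV hdV dW hdW p →
        Φ (p * x) = modDelta L e dV hdV dW hdW p * Φ x)
      (τ : ℝ)
      -- the archimedean slice
      (_harch : Integrable (fun a => Φ (iotaLeft L e dV hdV dW hdW (ιA (placesEmbed L H S (a, 1)))) ^ τ) νinf)
      -- the finite slices, one for each `v ∈ S`
      (_hfin : ∀ v : S, Integrable
        (fun u => Φ (iotaLeft L e dV hdV dW hdW (ιA (placesEmbed L H S (1, Pi.mulSingle v u)))) ^ τ) (νS v)),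
      Integrable (fun x => Φ (iotaLeft L e dV hdV dW hdW (ιA (placesEmbed L H S x))) ^ τ) (νinf.prod (Measure.pi νS)) := by
  intro L _ _ _ N n e dV hdV hdV0 dW hdW hdW0 H t ht g hg ιA hιA S _ _ _ _ _ νinf _ νS _ Φ hΦc hΦpos hΦ τ harch hfin
  -- Borel bookkeeping on `G_∞ × G_S` and `σ`-finiteness of the local Haar measures
  haveI : ∀ v, SecondCountableTopology (UnitaryGroup.localPi L (IsCMField.complexConj L) N H v) :=
    fun v => UnitaryGroup.secondCountableTopology_localPi L N (IsCMField.complexConj L) H v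
  haveI : ∀ v, LocallyCompactSpace (UnitaryGroup.localPi L (IsCMField.complexConj L) N H v) :=
    fun v => UnitaryGroup.locallyCompactSpace_localPi L N (IsCMField.complexConj L) H v
  haveI : SecondCountableTopology (Π v : S, UnitaryGroup.localPi L (IsCMField.complexConj L) N H v.1) := inferInstance
  haveI : SecondCountableTopologyEither (UnitaryGroup.arch (Fp L) L (IsCMField.complexConj L) N H)
      (Π v : S, UnitaryGroup.localPi L (IsCMField.complexConj L) N H v.1) := secondCountableTopologyEither_of_right _ _
  haveI : ∀ v : S, SigmaFinite (νS v) := fun v => inferInstance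
  -- continuity of the integrand
  obtain ⟨Ψ, -, hΨ⟩ := exists_continuousMulEquiv_eq_iotaA L H dV t ht g hg ιA hιA
  have hιc : Continuous ιA := by
    have h : (ιA : _ → _) = Ψ := funext fun x => (hΨ x).symm
    rw [h]
    exact Ψ.continuous
  have hh : Continuous fun x : UnitaryGroup.arch (Fp L) L (IsCMField.complexConj L) N H ×
      (Π v : S, UnitaryGroup.localPi L (IsCMField.complexConj L) N H v.1) =>
        iotaLeft L e dV hdV dW hdW (ιA (placesEmbed L H S x)) :=
    (continuous_iotaLeft L e dV hdV dW hdW).comp (hιc.comp (continuous_placesEmbed L H S))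
  have hmeas : AEStronglyMeasurable (fun x => Φ (iotaLeft L e dV hdV dW hdW (ιA (placesEmbed L H S x))) ^ τ)
      (νinf.prod (Measure.pi νS)) :=
    ((hΦc.comp hh).rpow_const fun x => Or.inl (hΦpos _).ne').aestronglyMeasurable
  -- the quasi-factorisation over `S` and the majorant
  obtain ⟨C, hC, hq⟩ := exists_twoSided_placesEmbed L e dV hdV dW hdW H g ιA hιA S hdV0 hdW0 hΦc hΦpos hΦ
  have hbound : Integrable (fun x : UnitaryGroup.arch (Fp L) L (IsCMField.complexConj L) N H ×
      (Π v : S, UnitaryGroup.localPi L (IsCMField.complexConj L) N H v.1) =>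
        max (C ^ τ) (C ^ (-τ)) * (Φ (iotaLeft L e dV hdV dW hdW (ιA (placesEmbed L H S (x.1, 1)))) ^ τ *
          ∏ v : S, Φ (iotaLeft L e dV hdV dW hdW (ιA (placesEmbed L H S (1, Pi.mulSingle v (x.2 v))))) ^ τ))
      (νinf.prod (Measure.pi νS)) :=
    (harch.mul_prod (Integrable.fintype_prod_dep fun v => hfin v)).const_mul _
  refine hbound.mono' hmeas (Filter.Eventually.of_forall fun x => ?_)
  rw [Real.norm_of_nonneg (Real.rpow_nonneg (hΦpos _).le τ)]
  have hx := hq x.1 x.2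
  have hP : 0 < ∏ v : S, Φ (iotaLeft L e dV hdV dW hdW (ιA (placesEmbed L H S (1, Pi.mulSingle v (x.2 v))))) :=
    Finset.prod_pos fun v _ => hΦpos _
  calc Φ (iotaLeft L e dV hdV dW hdW (ιA (placesEmbed L H S x))) ^ τ
      = Φ (iotaLeft L e dV hdV dW hdW (ιA (placesEmbed L H S (x.1, x.2)))) ^ τ := rfl
    _ ≤ max (C ^ τ) (C ^ (-τ)) * (Φ (iotaLeft L e dV hdV dW hdW (ιA (placesEmbed L H S (x.1, 1)))) *
          ∏ v : S, Φ (iotaLeft L e dV hdV dW hdW (ιA (placesEmbed L H S (1, Pi.mulSingle v (x.2 v)))))) ^ τ :=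
        rpow_le_max_mul_rpow (hΦpos _) (mul_pos (hΦpos _) hP) hC hx.1 hx.2
    _ = max (C ^ τ) (C ^ (-τ)) * (Φ (iotaLeft L e dV hdV dW hdW (ιA (placesEmbed L H S (x.1, 1)))) ^ τ *
          ∏ v : S, Φ (iotaLeft L e dV hdV dW hdW (ιA (placesEmbed L H S (1, Pi.mulSingle v (x.2 v))))) ^ τ) := by
        rw [Real.mul_rpow (hΦpos _).le hP.le, Real.finsetProd_rpow _ _ fun v _ => (hΦpos _).le]

end Summit.HodgeConjecture.HodgeConjecture.Cruxes.HLiu418.K2LiuDoublingHeightDecayLocalOfSlices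

end
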